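import Summits.QuantumFields.BalabanUV.Beta.GAN24.CombBornBorderUndressedRow
import Summits.QuantumFields.BalabanUV.Beta.GAN24.BornBorderUndressedDriftAn1
import Summits.QuantumFields.BalabanUV.Beta.GAN24.BornLambdaDriftSup
import Summits.QuantumFields.BalabanUV.Beta.GAN24.BornBorderDriftThree

/-!
# The (III′) V-born RATE half at an1's SYMMETRISED BORDER (END): **`hBd-V` FROM THE TWO V CONTACT LETTERS ALONE**, `d = 3`, `2 ≤ Lc`, pin `cE = Lc^4`,
# `tabs.V = symVhSAt (toSite rr) 3 Lc rfl` — the comb ∕ an1 twin of leaf-04's (E) `BornBorderDrift.exists_hBdevV_of_supLetters`, `BornBorderDriftThree` §3–§5 and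
# `BornBorderDriftAssembly` in M.77's RAW-table bookkeeping: the RAW UNDRESSED pairs («SYM-S3-V-DIFF»: `BornBorderUndressedDriftAn1.exists_pairU_v_sup_three` over
# `S3DiffVSymAn1At ∕ TopBorderKSlotSymAn1At`) and the RAW undressed lineage letter (M.89 `exists_hUgV_raw_three`) are DISCHARGED; the source `cVH • tabs.V` is level-free
# (zero fresh drift, M.56); what remains are the V CONTACT letter `hCv` (`C·(k−i)^p·θ^{k−i}`) and the V CONTACT PAIR letter `hPcV` (sup currency) — BOTH hypotheses of the END

NOT IN PRINT — OUR BOOKKEEPING (road-P2 = `b2b-balaban-gan24-p2` gen 56, 2026-08-25; row G-an2-4 ∕ (CONV-C), the (α-0) chain at row D1's literal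
OF RECORD (III′) `JsB12CombShSym`; [folklore] composition BY NAME — reindexing, the triangle inequality; 0 `def`, 0 cite, 0 `def … : Prop`, 0 `sorry`).  Weight 0.
SOCKETS: the V CONTACT letter `hCv` (dressed lineage minus RAW undressed lineage — it carries the transport defect `𝒯 − 1` AND the leg telescope `T″ − B`, M.77) and
the V CONTACT PAIR letter `hPcV` are OPEN at (III′) (the OWNER gan24-p1's `PsiFace` ∕ `CombLegEnvelope` words gate them); discharges NOTHING of (hS, hSall) by itself;
NEVER «G-an2-4 closed» as (CONV-C); NOT D1, NOT BetaPertH, NOT continuum, NOT Clay; NO campaign opened (an2 W-4) — typed while idle under R-2 (road-P2 MEMO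
M-gan24p2-g56-1, `gen56/S-CAMPAIGN-SIZING-g56.v0_7.md` §2(d)).

## Contents
§1 (generic `d`, a SOCKET; the sup-currency form of M.62's `CombBornDriftSockets.exists_hBdevV_of_letters`, twin of leaf-04's `BornBorderDrift.exists_hBdevV_of_supLetters`)
**`exists_hBdevV_of_supLetters`**: the row letter `hB` of the unit tables of `combBornOf Lc tabs cE cVH 0` + a top-lineage SUP letter + top-aligned pair SUP letters ⇒ the
all-scales Cauchy letter (leaf-06's schema `exists_consec_of_pairLetters` at locality rate `0` with the ZERO fresh drift over M.56's `unitS_combBornV_eq_sum`, then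
`locStencilCauchy_of_uniform_supRate`).
§2 (`d = 3`, UNCONDITIONAL) **`exists_pairU_v_raw_sup_three`**: the RAW UNDRESSED top-aligned pair letter, births `≥ 1`, sup currency, read on `tabs.V` (= `BornBorderUndressedDriftAn1.exists_pairU_v_sup_three` under `hV`).
§3 (`d = 3`) `exists_hT_v_three_of_contact`, `exists_pairZero_v_three_of_contact` (twins of `BornBorderDriftThree.exists_hT_v_three ∕ exists_pairZero_v_three` with the (E)
contact letter replaced by the HYPOTHESIS `hCv`, any log power `p`; the undressed letter is M.89's).
§4 (`d = 3`) `exists_hBdevV_three_of_supPairs_of_contact` (`hB` by M.77's `exists_hBv_of_rawGeometric_poly` over M.89, the top lineage by §3, then §1) and the END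
**`exists_hBdevV_three_of_contactPairs (hCv) (hPcV) : ∃ cB θB δB, 0 ≤ cB ∧ 0 ≤ θB ∧ θB < 1 ∧ 0 < δB ∧ ∀ k j, LocStencil (U_{k+j} − U_k) (cB·θB^k) δB`** for
`U_k = unitS (sfStep Lc k) (smStep 3 Lc k) (combBornOf Lc tabs cE cVH 0 k)` (dressed pair = RAW undressed pair (§2) + contact pair pointwise, the pair `i = 0` by §3, exponent `p + q`).
-/

noncomputable section

open Finset
open scoped BigOperators
open Literature.MathematicalPhysics.QuantumFieldTheory
open Literature.MathematicalPhysics.QuantumFieldTheory.Balaban1983to89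
open Literature.MathematicalPhysics.QuantumFieldTheory.Balaban1983to89.Beta
open ExpKernelCalculus (MKer)
open OneStepResolventKernel (Fib LocStencil)
open AffineAveraging (Site box toSite)
open BalabanCompositeJets (respStep)
open StepJetData (locStencil_add)
open Summit.QuantumFields.BalabanUV.Beta.HessKerDressedUnits (unitS)
open Summit.QuantumFields.BalabanUV.Beta.SymmetrisedStepJets (SymTables)
open Summit.QuantumFields.BalabanUV.Beta.SymAveragingHessianCounts (symVhSAt)
open Summit.QuantumFields.BalabanUV.Beta.GAN24.CombesThomas (sfStep smStep KStepUnit SupBound)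
open Summit.QuantumFields.BalabanUV.Beta.GAN24.StencilSlotOfShapes (locStencil_mono')
open Summit.QuantumFields.BalabanUV.Beta.GAN24.StencilSlotCauchyOfShapes (locStencil_sub)
open Summit.QuantumFields.BalabanUV.Beta.GAN24.StencilSlotSupRate (locStencilCauchy_of_uniform_supRate)
open Summit.QuantumFields.BalabanUV.Beta.GAN24.Push3 (push₃)
open Summit.QuantumFields.BalabanUV.Beta.GAN24.AffineUnroll (transport)
open Summit.QuantumFields.BalabanUV.Beta.GAN24.SrecLinearPartEq (colM rowMM reslot)
open Summit.QuantumFields.BalabanUV.Beta.GAN24.BornLambdaDrift (exists_consec_of_pairLetters)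
open Summit.QuantumFields.BalabanUV.Beta.GAN24.BornLambdaDriftSup (locStencil_zero_iff_supBound locStencil_zero_of_locStencil)
open Summit.QuantumFields.BalabanUV.Beta.GAN24.BornBorderDriftThree (locStencil_add_pi)
open Summit.QuantumFields.BalabanUV.Beta.GAN24.CombWilsonSector (combBornOf)
open Summit.QuantumFields.BalabanUV.Beta.GAN24.CombBornSector (combUnitStepMap)
open Summit.QuantumFields.BalabanUV.Beta.GAN24.CombBornBorderLineage (unitS_combBornV_eq_sum)
open Summit.QuantumFields.BalabanUV.Beta.GAN24.CombBornBorderLettersRaw (exists_hBv_of_rawGeometric_poly)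
open Summit.QuantumFields.BalabanUV.Beta.GAN24.CombBornBorderUndressedRow (exists_hUgV_raw_three)
open Summit.QuantumFields.BalabanUV.Beta.GAN24.BornBorderUndressedDriftAn1 (exists_pairU_v_sup_three)

namespace Summit.QuantumFields.BalabanUV.Beta.GAN24.CombBornBorderDriftAssembly

/-! ## §1 The V rate half from a uniform row letter and two sup letters (generic `d`; a SOCKET) -/

section Letters

variable {d : ℕ} {Lc : ℕ} [NeZero Lc] (tabs : SymTables d Lc)

/-- NOT IN PRINT; OUR BOOKKEEPING (generic `d`, centred comb roots; a SOCKET; the sup-currency form of M.62's `exists_hBdevV_of_letters`, twin of leaf-04's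
`BornBorderDrift.exists_hBdevV_of_supLetters`).  **THE RATE HALF OF THE (III′) V-BORN ROW FROM A UNIFORM LETTER AND TWO SUP-NORM LETTERS**: the `k`-uniform
local-stencil letter `hB` of the unit tables `U_k` of `combBornOf Lc tabs cE cVH 0`, a top-lineage SUP letter (`transport combUnitStepMap 1 k (combUnitStepMap Lc cE 0 (cVH • tabs.V))`,
constant `CT·(k+1)^p·θT^{k+1}`) and top-aligned pair SUP letters (`CP·(k−i)^q·Θ^k`, NO decay asked) give the all-scales Cauchy letter `LocStencil (U_{k+j} − U_k) (cB·θB^k) (δB∕2)`: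
the source `cVH • tabs.V` is THE SAME TABLE at every level (M.56), so leaf-06's schema runs at locality rate `0` with the ZERO fresh drift; then road S3's
`locStencilCauchy_of_uniform_supRate`. -/
theorem exists_hBdevV_of_supLetters (hVff : ∀ κ u x y (α β : Fin (d + 1)), tabs.V κ u x y (Sum.inl α) (Sum.inl β) = 0)
    (hVmm : ∀ κ u x y (μ ν : Fin (d + 1)), tabs.V κ u x y (Sum.inr μ) (Sum.inr ν) = 0) (cE cVH : ℝ) {p q : ℕ}
    (hB : ∃ CB δB : ℝ, 0 < δB ∧ ∀ k : ℕ, LocStencil (unitS (sfStep Lc k) (smStep d Lc k) (combBornOf Lc tabs cE cVH 0 k)) CB δB)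
    (hT : ∃ CT θT : ℝ, 0 ≤ CT ∧ 0 ≤ θT ∧ θT < 1 ∧ ∀ (k : ℕ) κ u,
      SupBound (transport (combUnitStepMap Lc cE) 1 k (combUnitStepMap Lc cE 0 (fun κ u => cVH • tabs.V κ u)) κ u) (CT * ((((k + 1 : ℕ) : ℝ)) ^ p * θT ^ (k + 1))))
    (hP : ∃ CP Θ : ℝ, 0 ≤ CP ∧ 0 ≤ Θ ∧ Θ < 1 ∧ ∀ k i : ℕ, i < k → ∀ κ u,
      SupBound
        ((transport (combUnitStepMap Lc cE) (i + 1 + 1) (k - 1 - i) (combUnitStepMap Lc cE (i + 1) (fun κ u => cVH • tabs.V κ u))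
          - transport (combUnitStepMap Lc cE) (i + 1) (k - 1 - i) (combUnitStepMap Lc cE i (fun κ u => cVH • tabs.V κ u))) κ u)
        (CP * ((((k - i : ℕ) : ℝ)) ^ q * Θ ^ k))) :
    ∃ cB θB δB : ℝ, 0 ≤ cB ∧ 0 ≤ θB ∧ θB < 1 ∧ 0 < δB ∧ ∀ k j : ℕ,
      LocStencil (unitS (sfStep Lc (k + j)) (smStep d Lc (k + j)) (combBornOf Lc tabs cE cVH 0 (k + j))
        - unitS (sfStep Lc k) (smStep d Lc k) (combBornOf Lc tabs cE cVH 0 k)) (cB * θB ^ k) δB := by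
  obtain ⟨CB, δB, hδB, hB⟩ := hB
  obtain ⟨CT, θT, hCT, hθT0, hθT1, hT⟩ := hT
  obtain ⟨CP, Θ, hCP, hΘ0, hΘ1, hP⟩ := hP
  -- leaf-06's schema at locality rate 0 with the ZERO fresh drift (`CF = 0`, `θF = 0`)
  obtain ⟨c, θ, hc, hθ0, hθ1, hschema⟩ :=
    exists_consec_of_pairLetters (d := d) (δ := 0) (p := p) (q := q) (le_refl (0 : ℝ)) (le_refl (0 : ℝ)) zero_lt_one hCT hθT0 hθT1 hCP hΘ0 hΘ1
  have hCB : 0 ≤ CB := ((hB 0) 0 0).nonneg (Sum.inl 0)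
  have h1θ : 0 < 1 - θ := by linarith
  refine ⟨Real.sqrt (2 * (c / (1 - θ)) * CB), Real.sqrt θ, δB / 2, Real.sqrt_nonneg _, Real.sqrt_nonneg _,
    (Real.sqrt_lt' one_pos).2 (by rwa [one_pow]), by positivity, fun k j => ?_⟩
  have hF : ∀ k : ℕ, LocStencil ((fun _ : ℕ => fun κ u => cVH • tabs.V κ u) (k + 1) - (fun _ : ℕ => fun κ u => cVH • tabs.V κ u) k) (0 * (0 : ℝ) ^ k) 0 := by
    intro k
    simp only [sub_self, zero_mul]
    intro κ u x y a b
    simp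
  -- the one-step sup rate
  have hrate : ∀ (n : ℕ) κ u, SupBound (unitS (sfStep Lc (n + 1)) (smStep d Lc (n + 1)) (combBornOf Lc tabs cE cVH 0 (n + 1)) κ u
      - unitS (sfStep Lc n) (smStep d Lc n) (combBornOf Lc tabs cE cVH 0 n) κ u) (c * θ ^ n) := by
    intro n
    have h0 : LocStencil (unitS (sfStep Lc (n + 1)) (smStep d Lc (n + 1)) (combBornOf Lc tabs cE cVH 0 (n + 1))
        - unitS (sfStep Lc n) (smStep d Lc n) (combBornOf Lc tabs cE cVH 0 n)) (c * θ ^ n) 0 := by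
      rw [unitS_combBornV_eq_sum tabs hVff hVmm cE cVH (n + 1), unitS_combBornV_eq_sum tabs hVff hVmm cE cVH n]
      refine hschema (fun _ => fun κ u => cVH • tabs.V κ u)
        (fun i k => transport (combUnitStepMap Lc cE) (i + 1) (k - 1 - i) (combUnitStepMap Lc cE i (fun κ u => cVH • tabs.V κ u)))
        hF (fun k => ?_) (fun k i hik => ?_) n
      · have h := locStencil_zero_iff_supBound.2 (hT k)
        rw [show k + 1 - 1 - 0 = k by omega]
        exact h
      · have h := locStencil_zero_iff_supBound.2 (hP k i hik)
        rw [show k + 1 - 1 - (i + 1) = k - 1 - i by omega]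
        exact h
    intro κ u
    exact (locStencil_zero_iff_supBound.1 h0) κ u
  exact locStencilCauchy_of_uniform_supRate (F := fun n => unitS (sfStep Lc n) (smStep d Lc n) (combBornOf Lc tabs cE cVH 0 n))
    (fun n => hB n) hrate hc hθ0.le hθ1 k j

end Letters

/-! ## §2 `d = 3`: the RAW UNDRESSED top-aligned pair letter on `tabs.V = symVhSAt (toSite rr)`, births `≥ 1`, sup currency — UNCONDITIONAL -/

section Three

variable {Lc : ℕ} [NeZero Lc] (tabs : SymTables 3 Lc) (hVff : ∀ κ u x y (α β : Fin (3 + 1)), tabs.V κ u x y (Sum.inl α) (Sum.inl β) = 0)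
  (hVmm : ∀ κ u x y (μ ν : Fin (3 + 1)), tabs.V κ u x y (Sum.inr μ) (Sum.inr ν) = 0)

/-- NOT IN PRINT; OUR BOOKKEEPING (`d = 3`, `2 ≤ Lc`, pin `cE = Lc^4`, `tabs.V = symVhSAt (toSite rr) 3 Lc rfl`, UNCONDITIONAL; = leaf-04's rooted DIFF rows R3-dV ∕ R3-dVt
re-run for an1's symmetrised border, `BornBorderUndressedDriftAn1.exists_pairU_v_sup_three`, read on the record's `tabs.V`).  **THE RAW UNDRESSED TOP-ALIGNED PAIR
LETTER, BIRTHS `≥ 1`, SUP CURRENCY**: ONE `CU ≥ 0`, ONE `0 < Θ < 1` with, for every `1 ≤ i < k` and every entry, `|U⁰_{i+1,k+1} − U⁰_{i,k}| ≤ CU·Θ^k` for M.77's RAW undressed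
lineages `U⁰_{i,k} = (cE·Lc^8)^{k−i} • push₃ B_{i+1,k}³ Y⁰_i`. -/
theorem exists_pairU_v_raw_sup_three (hLc : 2 ≤ Lc) {rr : Fin (3 + 1) → ℕ} (hrr : rr ∈ box (3 + 1) Lc) (hV : tabs.V = symVhSAt (toSite rr) 3 Lc rfl)
    {cE : ℝ} (hcE : cE = (Lc : ℝ) ^ (3 + 1)) (cVH : ℝ) :
    ∃ CU Θ : ℝ, 0 ≤ CU ∧ 0 < Θ ∧ Θ < 1 ∧ ∀ k i : ℕ, 1 ≤ i → i < k → ∀ κ u,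
      SupBound
        (((fun κ' u' => (cE * (Lc : ℝ) ^ (2 * (3 + 1))) ^ (k - i) •
          push₃ (respStep (d := 3) (Lc ^ ((i + 1) + 1)) (Lc ^ (k + 1))) (respStep (d := 3) (Lc ^ ((i + 1) + 1)) (Lc ^ (k + 1))) (respStep (d := 3) (Lc ^ ((i + 1) + 1)) (Lc ^ (k + 1)))
            (fun κ u => -(push₃ (-respStep (d := 3) (Lc ^ (i + 1)) (Lc ^ ((i + 1) + 1))) (colM (KStepUnit (d := 3) Lc (i + 1)) Lc)
                  (respStep (d := 3) (Lc ^ (i + 1)) (Lc ^ ((i + 1) + 1))) (reslot Sum.inl Sum.inr fun κ u => cVH • SymTables.V tabs κ u) κ u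
              + push₃ (rowMM (KStepUnit (d := 3) Lc (i + 1)) Lc) (respStep (d := 3) (Lc ^ (i + 1)) (Lc ^ ((i + 1) + 1)))
                  (respStep (d := 3) (Lc ^ (i + 1)) (Lc ^ ((i + 1) + 1))) (reslot Sum.inr Sum.inl fun κ u => cVH • SymTables.V tabs κ u) κ u)) κ' u')
          - (fun κ' u' => (cE * (Lc : ℝ) ^ (2 * (3 + 1))) ^ (k - i) •
          push₃ (respStep (d := 3) (Lc ^ (i + 1)) (Lc ^ k)) (respStep (d := 3) (Lc ^ (i + 1)) (Lc ^ k)) (respStep (d := 3) (Lc ^ (i + 1)) (Lc ^ k))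
            (fun κ u => -(push₃ (-respStep (d := 3) (Lc ^ i) (Lc ^ (i + 1))) (colM (KStepUnit (d := 3) Lc i) Lc)
                  (respStep (d := 3) (Lc ^ i) (Lc ^ (i + 1))) (reslot Sum.inl Sum.inr fun κ u => cVH • SymTables.V tabs κ u) κ u
              + push₃ (rowMM (KStepUnit (d := 3) Lc i) Lc) (respStep (d := 3) (Lc ^ i) (Lc ^ (i + 1)))
                  (respStep (d := 3) (Lc ^ i) (Lc ^ (i + 1))) (reslot Sum.inr Sum.inl fun κ u => cVH • SymTables.V tabs κ u) κ u)) κ' u')) κ u)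
        (CU * Θ ^ k) := by
  obtain ⟨CU, Θ, hCU, hΘ0, hΘ1, h⟩ := exists_pairU_v_sup_three (Lc := Lc) hLc hcE cVH
  refine ⟨CU, Θ, hCU, hΘ0, hΘ1, fun k i hi hik => ?_⟩
  rw [hV]
  exact h rr hrr k i hi hik

/-! ## §3 `d = 3`: the top lineage and the pair `i = 0` from M.89's RAW undressed letter and the CONTACT letter `hCv` (hypothesis, any log power `p`) -/

/-- NOT IN PRINT; OUR BOOKKEEPING (`d = 3`, `2 ≤ Lc`, pin `cE = Lc^4`; twin of leaf-04's `BornBorderDriftThree.exists_hT_v_three` with the (E) contact letter replaced by the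
HYPOTHESIS `hCv`).  **THE TOP V LINEAGE IS GEOMETRIC WITH `p` LOGS**: the dressed lineage born at the finest level observed at `k+1`
(`transport combUnitStepMap 1 k (combUnitStepMap Lc cE 0 (cVH • tabs.V))`) = RAW undressed (M.89 `exists_hUgV_raw_three` at `i = 0`: `C·θ^{k+1}`) + contact (`hCv` at `i = 0`:
`C·(k+1)^p·θ^{k+1}`) ⇒ constant `CT·(k+1)^p·θT^{k+1}`. -/
theorem exists_hT_v_three_of_contact (hLc : 2 ≤ Lc) {rr : Fin (3 + 1) → ℕ} (hrr : rr ∈ box (3 + 1) Lc) (hV : tabs.V = symVhSAt (toSite rr) 3 Lc rfl)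
    {cE : ℝ} (hcE : cE = (Lc : ℝ) ^ (3 + 1)) (cVH : ℝ) {p : ℕ}
    (hCv : ∃ C θ δ : ℝ, 0 ≤ C ∧ 0 ≤ θ ∧ θ < 1 ∧ 0 < δ ∧ ∀ k i : ℕ, i < k →
      LocStencil (transport (combUnitStepMap Lc cE) (i + 1) (k - 1 - i) (combUnitStepMap Lc cE i (fun κ u => cVH • tabs.V κ u))
        - (fun κ' u' => (cE * (Lc : ℝ) ^ (2 * (3 + 1))) ^ (k - i) •
          push₃ (respStep (d := 3) (Lc ^ (i + 1)) (Lc ^ k)) (respStep (d := 3) (Lc ^ (i + 1)) (Lc ^ k)) (respStep (d := 3) (Lc ^ (i + 1)) (Lc ^ k))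
            (fun κ u => -(push₃ (-respStep (d := 3) (Lc ^ i) (Lc ^ (i + 1))) (colM (KStepUnit (d := 3) Lc i) Lc)
                  (respStep (d := 3) (Lc ^ i) (Lc ^ (i + 1))) (reslot Sum.inl Sum.inr fun κ u => cVH • SymTables.V tabs κ u) κ u
              + push₃ (rowMM (KStepUnit (d := 3) Lc i) Lc) (respStep (d := 3) (Lc ^ i) (Lc ^ (i + 1)))
                  (respStep (d := 3) (Lc ^ i) (Lc ^ (i + 1))) (reslot Sum.inr Sum.inl fun κ u => cVH • SymTables.V tabs κ u) κ u)) κ' u')) (C * ((((k - i : ℕ) : ℝ)) ^ p * θ ^ (k - i))) δ) :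
    ∃ CT θT δT : ℝ, 0 ≤ CT ∧ 0 ≤ θT ∧ θT < 1 ∧ 0 < δT ∧ ∀ k : ℕ,
      LocStencil (transport (combUnitStepMap Lc cE) 1 k (combUnitStepMap Lc cE 0 (fun κ u => cVH • tabs.V κ u))) (CT * ((((k + 1 : ℕ) : ℝ)) ^ p * θT ^ (k + 1))) δT := by
  obtain ⟨C₁, θ₁, δ₁, hC₁, hθ₁0, hθ₁1, hδ₁, hU⟩ := exists_hUgV_raw_three tabs hLc hrr hV hcE cVH
  obtain ⟨C₂, θ₂, δ₂, hC₂, hθ₂0, hθ₂1, hδ₂, hC⟩ := hCv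
  set θT : ℝ := max θ₁ θ₂ with hθT
  have hθT0 : 0 ≤ θT := le_max_of_le_left hθ₁0
  have hθT1 : θT < 1 := max_lt hθ₁1 hθ₂1
  refine ⟨C₁ + C₂, θT, min δ₁ δ₂, by positivity, hθT0, hθT1, lt_min hδ₁ hδ₂, fun k => ?_⟩
  have h1 := locStencil_mono' (hU (k + 1) 0 (Nat.zero_lt_succ k)) le_rfl (min_le_left δ₁ δ₂)
  have h2 := locStencil_mono' (hC (k + 1) 0 (Nat.zero_lt_succ k)) le_rfl (min_le_right δ₁ δ₂)
  have h := locStencil_add_pi h1 h2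
  rw [add_sub_cancel] at h
  simp only [Nat.sub_zero, Nat.add_sub_cancel, Nat.zero_add] at h
  refine locStencil_mono' h ?_ le_rfl
  -- `C₁ θ₁^(k+1) + C₂ (k+1)^p θ₂^(k+1) ≤ (C₁ + C₂) (k+1)^p θT^(k+1)`
  have hk1 : (1 : ℝ) ≤ ((k + 1 : ℕ) : ℝ) := by exact_mod_cast Nat.succ_le_succ (Nat.zero_le k)
  have hX1 : (1 : ℝ) ≤ (((k + 1 : ℕ) : ℝ)) ^ p := one_le_pow₀ hk1
  have hp1 : θ₁ ^ (k + 1) ≤ θT ^ (k + 1) := pow_le_pow_left₀ hθ₁0 (le_max_left _ _) _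
  have hp2 : θ₂ ^ (k + 1) ≤ θT ^ (k + 1) := pow_le_pow_left₀ hθ₂0 (le_max_right _ _) _
  have hTk : 0 ≤ θT ^ (k + 1) := pow_nonneg hθT0 _
  have hA : C₁ * θ₁ ^ (k + 1) ≤ C₁ * ((((k + 1 : ℕ) : ℝ)) ^ p * θT ^ (k + 1)) :=
    mul_le_mul_of_nonneg_left (hp1.trans (le_mul_of_one_le_left hTk hX1)) hC₁
  have hB : C₂ * ((((k + 1 : ℕ) : ℝ)) ^ p * θ₂ ^ (k + 1)) ≤ C₂ * ((((k + 1 : ℕ) : ℝ)) ^ p * θT ^ (k + 1)) :=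
    mul_le_mul_of_nonneg_left (mul_le_mul_of_nonneg_left hp2 (by positivity)) hC₂
  have e2 : (C₁ + C₂) * ((((k + 1 : ℕ) : ℝ)) ^ p * θT ^ (k + 1)) =
      C₁ * ((((k + 1 : ℕ) : ℝ)) ^ p * θT ^ (k + 1)) + C₂ * ((((k + 1 : ℕ) : ℝ)) ^ p * θT ^ (k + 1)) := by ring
  rw [e2]
  push_cast at hA hB ⊢
  exact add_le_add hA hB

/-- NOT IN PRINT; OUR BOOKKEEPING (`d = 3`, `2 ≤ Lc`, pin `cE = Lc^4`; twin of leaf-04's `BornBorderDriftThree.exists_pairZero_v_three` with the (E) contact letter replaced by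
the HYPOTHESIS `hCv`).  **THE TOP-ALIGNED V PAIR AT BIRTH LEVEL `0` NEEDS NO CAUCHY INPUT**: member `k+1`'s dressed lineage born at `1` and member `k`'s born at `0` (`k ≥ 1`)
are EACH bounded by the lineage letters (M.89 + `hCv`), so their difference is a local stencil family with constant `C·k^p·Θ^k` — the `i = 0` instance of §1's `hP`
(indices left raw: `0 + 1 + 1`, `k - 1 - 0`, `0 + 1`, `k - 0`). -/
theorem exists_pairZero_v_three_of_contact (hLc : 2 ≤ Lc) {rr : Fin (3 + 1) → ℕ} (hrr : rr ∈ box (3 + 1) Lc) (hV : tabs.V = symVhSAt (toSite rr) 3 Lc rfl)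
    {cE : ℝ} (hcE : cE = (Lc : ℝ) ^ (3 + 1)) (cVH : ℝ) {p : ℕ}
    (hCv : ∃ C θ δ : ℝ, 0 ≤ C ∧ 0 ≤ θ ∧ θ < 1 ∧ 0 < δ ∧ ∀ k i : ℕ, i < k →
      LocStencil (transport (combUnitStepMap Lc cE) (i + 1) (k - 1 - i) (combUnitStepMap Lc cE i (fun κ u => cVH • tabs.V κ u))
        - (fun κ' u' => (cE * (Lc : ℝ) ^ (2 * (3 + 1))) ^ (k - i) •
          push₃ (respStep (d := 3) (Lc ^ (i + 1)) (Lc ^ k)) (respStep (d := 3) (Lc ^ (i + 1)) (Lc ^ k)) (respStep (d := 3) (Lc ^ (i + 1)) (Lc ^ k))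
            (fun κ u => -(push₃ (-respStep (d := 3) (Lc ^ i) (Lc ^ (i + 1))) (colM (KStepUnit (d := 3) Lc i) Lc)
                  (respStep (d := 3) (Lc ^ i) (Lc ^ (i + 1))) (reslot Sum.inl Sum.inr fun κ u => cVH • SymTables.V tabs κ u) κ u
              + push₃ (rowMM (KStepUnit (d := 3) Lc i) Lc) (respStep (d := 3) (Lc ^ i) (Lc ^ (i + 1)))
                  (respStep (d := 3) (Lc ^ i) (Lc ^ (i + 1))) (reslot Sum.inr Sum.inl fun κ u => cVH • SymTables.V tabs κ u) κ u)) κ' u')) (C * ((((k - i : ℕ) : ℝ)) ^ p * θ ^ (k - i))) δ) :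
    ∃ CP Θ δP : ℝ, 0 ≤ CP ∧ 0 ≤ Θ ∧ Θ < 1 ∧ 0 < δP ∧ ∀ k : ℕ, 0 < k →
      LocStencil
        (transport (combUnitStepMap Lc cE) (0 + 1 + 1) (k - 1 - 0) (combUnitStepMap Lc cE (0 + 1) (fun κ u => cVH • tabs.V κ u))
          - transport (combUnitStepMap Lc cE) (0 + 1) (k - 1 - 0) (combUnitStepMap Lc cE 0 (fun κ u => cVH • tabs.V κ u)))
        (CP * ((((k - 0 : ℕ) : ℝ)) ^ p * Θ ^ k)) δP := by
  obtain ⟨C₁, θ₁, δ₁, hC₁, hθ₁0, hθ₁1, hδ₁, hU⟩ := exists_hUgV_raw_three tabs hLc hrr hV hcE cVH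
  obtain ⟨C₂, θ₂, δ₂, hC₂, hθ₂0, hθ₂1, hδ₂, hC⟩ := hCv
  set Θ : ℝ := max θ₁ θ₂ with hΘ
  have hΘ0 : 0 ≤ Θ := le_max_of_le_left hθ₁0
  have hΘ1 : Θ < 1 := max_lt hθ₁1 hθ₂1
  refine ⟨C₁ + C₂ + (C₁ + C₂), Θ, min δ₁ δ₂, by positivity, hΘ0, hΘ1, lt_min hδ₁ hδ₂, fun k hk => ?_⟩
  -- a dressed lineage = RAW undressed + contact, as `LocStencil` families with the two letters added
  have hmem : ∀ i n : ℕ, i < n → LocStencil (transport (combUnitStepMap Lc cE) (i + 1) (n - 1 - i) (combUnitStepMap Lc cE i (fun κ u => cVH • tabs.V κ u)))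
      (C₁ * θ₁ ^ (n - i) + C₂ * ((((n - i : ℕ) : ℝ)) ^ p * θ₂ ^ (n - i))) (min δ₁ δ₂) := by
    intro i n hin
    have h1 := locStencil_mono' (hU n i hin) le_rfl (min_le_left δ₁ δ₂)
    have h2 := locStencil_mono' (hC n i hin) le_rfl (min_le_right δ₁ δ₂)
    have h := locStencil_add_pi h1 h2
    rw [add_sub_cancel] at h
    exact h
  have ha := hmem 1 (k + 1) (by omega)
  have hb := hmem 0 k hk
  simp only [Nat.add_sub_cancel, Nat.sub_zero, Nat.zero_add] at ha hb
  simp only [Nat.sub_zero, Nat.zero_add]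
  have hab := locStencil_sub ha hb
  refine locStencil_mono' hab ?_ le_rfl
  -- `(C₁ θ₁^k + C₂ k^p θ₂^k) + (C₁ θ₁^k + C₂ k^p θ₂^k) ≤ (C₁ + C₂ + (C₁ + C₂))·k^p·Θ^k` for `k ≥ 1`
  have hk1 : (1 : ℝ) ≤ (k : ℝ) := by exact_mod_cast hk
  have hX1 : (1 : ℝ) ≤ (k : ℝ) ^ p := one_le_pow₀ hk1
  have hp1 : θ₁ ^ k ≤ Θ ^ k := pow_le_pow_left₀ hθ₁0 (le_max_left _ _) _
  have hp2 : θ₂ ^ k ≤ Θ ^ k := pow_le_pow_left₀ hθ₂0 (le_max_right _ _) _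
  have hTk : 0 ≤ Θ ^ k := pow_nonneg hΘ0 _
  have hA : C₁ * θ₁ ^ k ≤ C₁ * ((k : ℝ) ^ p * Θ ^ k) :=
    mul_le_mul_of_nonneg_left (hp1.trans (le_mul_of_one_le_left hTk hX1)) hC₁
  have hB : C₂ * ((k : ℝ) ^ p * θ₂ ^ k) ≤ C₂ * ((k : ℝ) ^ p * Θ ^ k) :=
    mul_le_mul_of_nonneg_left (mul_le_mul_of_nonneg_left hp2 (by positivity)) hC₂
  have e2 : (C₁ + C₂ + (C₁ + C₂)) * ((k : ℝ) ^ p * Θ ^ k) =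
      (C₁ * ((k : ℝ) ^ p * Θ ^ k) + C₂ * ((k : ℝ) ^ p * Θ ^ k)) + (C₁ * ((k : ℝ) ^ p * Θ ^ k) + C₂ * ((k : ℝ) ^ p * Θ ^ k)) := by ring
  rw [e2]
  exact add_le_add (add_le_add hA hB) (add_le_add hA hB)

/-! ## §4 `d = 3`: `hBd-V` from the contact letter and the top-aligned pair letters; the END from the two V CONTACT letters -/

include hVff hVmm in
/-- NOT IN PRINT; OUR PROOF ATTEMPT — A SOCKET (`d = 3`, `2 ≤ Lc`, pin `cE = Lc^4`, `tabs.V = symVhSAt (toSite rr) 3 Lc rfl`; twin of leaf-04's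
`BornBorderDriftThree.exists_hBdevV_three_of_supPairs` with the (E) row and top letters replaced by M.77 ∕ M.89 + `hCv`).  **`hBd-V` OF THE (III′) FAMILY FROM THE V
CONTACT LETTER AND THE TOP-ALIGNED PAIR LETTERS IN SUP CURRENCY**: `hB` by M.77's `exists_hBv_of_rawGeometric_poly` over M.89's `exists_hUgV_raw_three`, the top
lineage by §3 (decay forgotten), then §1. -/
theorem exists_hBdevV_three_of_supPairs_of_contact (hLc : 2 ≤ Lc) {rr : Fin (3 + 1) → ℕ} (hrr : rr ∈ box (3 + 1) Lc)
    (hV : tabs.V = symVhSAt (toSite rr) 3 Lc rfl) {cE : ℝ} (hcE : cE = (Lc : ℝ) ^ (3 + 1)) (cVH : ℝ) {p q : ℕ}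
    (hCv : ∃ C θ δ : ℝ, 0 ≤ C ∧ 0 ≤ θ ∧ θ < 1 ∧ 0 < δ ∧ ∀ k i : ℕ, i < k →
      LocStencil (transport (combUnitStepMap Lc cE) (i + 1) (k - 1 - i) (combUnitStepMap Lc cE i (fun κ u => cVH • tabs.V κ u))
        - (fun κ' u' => (cE * (Lc : ℝ) ^ (2 * (3 + 1))) ^ (k - i) •
          push₃ (respStep (d := 3) (Lc ^ (i + 1)) (Lc ^ k)) (respStep (d := 3) (Lc ^ (i + 1)) (Lc ^ k)) (respStep (d := 3) (Lc ^ (i + 1)) (Lc ^ k))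
            (fun κ u => -(push₃ (-respStep (d := 3) (Lc ^ i) (Lc ^ (i + 1))) (colM (KStepUnit (d := 3) Lc i) Lc)
                  (respStep (d := 3) (Lc ^ i) (Lc ^ (i + 1))) (reslot Sum.inl Sum.inr fun κ u => cVH • SymTables.V tabs κ u) κ u
              + push₃ (rowMM (KStepUnit (d := 3) Lc i) Lc) (respStep (d := 3) (Lc ^ i) (Lc ^ (i + 1)))
                  (respStep (d := 3) (Lc ^ i) (Lc ^ (i + 1))) (reslot Sum.inr Sum.inl fun κ u => cVH • SymTables.V tabs κ u) κ u)) κ' u')) (C * ((((k - i : ℕ) : ℝ)) ^ p * θ ^ (k - i))) δ)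
    (hP : ∃ CP Θ : ℝ, 0 ≤ CP ∧ 0 ≤ Θ ∧ Θ < 1 ∧ ∀ k i : ℕ, i < k → ∀ κ u,
      SupBound
        ((transport (combUnitStepMap Lc cE) (i + 1 + 1) (k - 1 - i) (combUnitStepMap Lc cE (i + 1) (fun κ u => cVH • tabs.V κ u))
          - transport (combUnitStepMap Lc cE) (i + 1) (k - 1 - i) (combUnitStepMap Lc cE i (fun κ u => cVH • tabs.V κ u))) κ u)
        (CP * ((((k - i : ℕ) : ℝ)) ^ q * Θ ^ k))) :
    ∃ cB θB δB : ℝ, 0 ≤ cB ∧ 0 ≤ θB ∧ θB < 1 ∧ 0 < δB ∧ ∀ k j : ℕ,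
      LocStencil (unitS (sfStep Lc (k + j)) (smStep 3 Lc (k + j)) (combBornOf Lc tabs cE cVH 0 (k + j))
        - unitS (sfStep Lc k) (smStep 3 Lc k) (combBornOf Lc tabs cE cVH 0 k)) (cB * θB ^ k) δB := by
  obtain ⟨CT, θT, δT, hCT, hθT0, hθT1, hδT, hT⟩ := exists_hT_v_three_of_contact tabs hLc hrr hV hcE cVH hCv
  refine exists_hBdevV_of_supLetters (d := 3) tabs hVff hVmm (p := p) cE cVH
    (exists_hBv_of_rawGeometric_poly tabs hVff hVmm cE cVH p (exists_hUgV_raw_three tabs hLc hrr hV hcE cVH) hCv)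
    ⟨CT, θT, hCT, hθT0, hθT1, fun k => locStencil_zero_iff_supBound.1 (locStencil_zero_of_locStencil (hT k) hδT.le)⟩ hP

include hVff hVmm in
/-- NOT IN PRINT; OUR PROOF ATTEMPT — A SOCKET, THE END (`d = 3`, `2 ≤ Lc`, pin `cE = Lc^4`, `tabs.V = symVhSAt (toSite rr) 3 Lc rfl`; twin of leaf-04's
`BornBorderDriftAssembly.exists_hBdevV_three_of_contactPairs`).  **THE RATE HALF `hBd-V` OF THE (III′) V-BORN ROW FROM THE TWO V CONTACT LETTERS ALONE**: GIVEN the V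
contact letter `hCv` (every dressed lineage minus its RAW undressed lineage: `C·(k−i)^p·θ^{k−i}`, one locality rate) and the V contact PAIR letter `hPcV` (births `i ≥ 1`:
the contact lineage of member `k+1` born at `i+1` minus that of member `k` born at `i`, `CPc·(k−i)^q·Θc^k` entrywise, NO decay asked), the unit tables of
`combBornOf Lc tabs cE cVH 0` obey the all-scales Cauchy letter with ONE `cB`, ONE `θB < 1`, ONE `δB > 0`: the dressed pair = RAW undressed pair (§2, UNCONDITIONAL) +
contact pair pointwise, the pair `i = 0` by §3, then the socket above with exponent `p + q`.  Both hypotheses are OPEN at (III′); NOT hSdev of the comb family; NEVER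
«G-an2-4 closed». -/
theorem exists_hBdevV_three_of_contactPairs (hLc : 2 ≤ Lc) {rr : Fin (3 + 1) → ℕ} (hrr : rr ∈ box (3 + 1) Lc)
    (hV : tabs.V = symVhSAt (toSite rr) 3 Lc rfl) {cE : ℝ} (hcE : cE = (Lc : ℝ) ^ (3 + 1)) (cVH : ℝ) {p q : ℕ}
    (hCv : ∃ C θ δ : ℝ, 0 ≤ C ∧ 0 ≤ θ ∧ θ < 1 ∧ 0 < δ ∧ ∀ k i : ℕ, i < k →
      LocStencil (transport (combUnitStepMap Lc cE) (i + 1) (k - 1 - i) (combUnitStepMap Lc cE i (fun κ u => cVH • tabs.V κ u))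
        - (fun κ' u' => (cE * (Lc : ℝ) ^ (2 * (3 + 1))) ^ (k - i) •
          push₃ (respStep (d := 3) (Lc ^ (i + 1)) (Lc ^ k)) (respStep (d := 3) (Lc ^ (i + 1)) (Lc ^ k)) (respStep (d := 3) (Lc ^ (i + 1)) (Lc ^ k))
            (fun κ u => -(push₃ (-respStep (d := 3) (Lc ^ i) (Lc ^ (i + 1))) (colM (KStepUnit (d := 3) Lc i) Lc)
                  (respStep (d := 3) (Lc ^ i) (Lc ^ (i + 1))) (reslot Sum.inl Sum.inr fun κ u => cVH • SymTables.V tabs κ u) κ u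
              + push₃ (rowMM (KStepUnit (d := 3) Lc i) Lc) (respStep (d := 3) (Lc ^ i) (Lc ^ (i + 1)))
                  (respStep (d := 3) (Lc ^ i) (Lc ^ (i + 1))) (reslot Sum.inr Sum.inl fun κ u => cVH • SymTables.V tabs κ u) κ u)) κ' u')) (C * ((((k - i : ℕ) : ℝ)) ^ p * θ ^ (k - i))) δ)
    (hPcV : ∃ CPc Θc : ℝ, 0 ≤ CPc ∧ 0 ≤ Θc ∧ Θc < 1 ∧ ∀ k i : ℕ, 1 ≤ i → i < k → ∀ κ u,
      SupBound
        (((transport (combUnitStepMap Lc cE) (i + 1 + 1) (k - 1 - i) (combUnitStepMap Lc cE (i + 1) (fun κ u => cVH • tabs.V κ u))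
            - (fun κ' u' => (cE * (Lc : ℝ) ^ (2 * (3 + 1))) ^ (k - i) •
          push₃ (respStep (d := 3) (Lc ^ ((i + 1) + 1)) (Lc ^ (k + 1))) (respStep (d := 3) (Lc ^ ((i + 1) + 1)) (Lc ^ (k + 1))) (respStep (d := 3) (Lc ^ ((i + 1) + 1)) (Lc ^ (k + 1)))
            (fun κ u => -(push₃ (-respStep (d := 3) (Lc ^ (i + 1)) (Lc ^ ((i + 1) + 1))) (colM (KStepUnit (d := 3) Lc (i + 1)) Lc)
                  (respStep (d := 3) (Lc ^ (i + 1)) (Lc ^ ((i + 1) + 1))) (reslot Sum.inl Sum.inr fun κ u => cVH • SymTables.V tabs κ u) κ u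
              + push₃ (rowMM (KStepUnit (d := 3) Lc (i + 1)) Lc) (respStep (d := 3) (Lc ^ (i + 1)) (Lc ^ ((i + 1) + 1)))
                  (respStep (d := 3) (Lc ^ (i + 1)) (Lc ^ ((i + 1) + 1))) (reslot Sum.inr Sum.inl fun κ u => cVH • SymTables.V tabs κ u) κ u)) κ' u'))
          - (transport (combUnitStepMap Lc cE) (i + 1) (k - 1 - i) (combUnitStepMap Lc cE i (fun κ u => cVH • tabs.V κ u))
            - (fun κ' u' => (cE * (Lc : ℝ) ^ (2 * (3 + 1))) ^ (k - i) •
          push₃ (respStep (d := 3) (Lc ^ (i + 1)) (Lc ^ k)) (respStep (d := 3) (Lc ^ (i + 1)) (Lc ^ k)) (respStep (d := 3) (Lc ^ (i + 1)) (Lc ^ k))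
            (fun κ u => -(push₃ (-respStep (d := 3) (Lc ^ i) (Lc ^ (i + 1))) (colM (KStepUnit (d := 3) Lc i) Lc)
                  (respStep (d := 3) (Lc ^ i) (Lc ^ (i + 1))) (reslot Sum.inl Sum.inr fun κ u => cVH • SymTables.V tabs κ u) κ u
              + push₃ (rowMM (KStepUnit (d := 3) Lc i) Lc) (respStep (d := 3) (Lc ^ i) (Lc ^ (i + 1)))
                  (respStep (d := 3) (Lc ^ i) (Lc ^ (i + 1))) (reslot Sum.inr Sum.inl fun κ u => cVH • SymTables.V tabs κ u) κ u)) κ' u'))) κ u)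
        (CPc * ((((k - i : ℕ) : ℝ)) ^ q * Θc ^ k))) :
    ∃ cB θB δB : ℝ, 0 ≤ cB ∧ 0 ≤ θB ∧ θB < 1 ∧ 0 < δB ∧ ∀ k j : ℕ,
      LocStencil (unitS (sfStep Lc (k + j)) (smStep 3 Lc (k + j)) (combBornOf Lc tabs cE cVH 0 (k + j))
        - unitS (sfStep Lc k) (smStep 3 Lc k) (combBornOf Lc tabs cE cVH 0 k)) (cB * θB ^ k) δB := by
  obtain ⟨CPc, Θc, hCPc, hΘc0, hΘc1, hPc⟩ := hPcV
  obtain ⟨CU, ΘU, hCU, hΘU0, hΘU1, hU⟩ := exists_pairU_v_raw_sup_three tabs hLc hrr hV hcE cVH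
  obtain ⟨C₀, Θ₀, δ₀, hC₀, hΘ₀0, hΘ₀1, hδ₀, hZ⟩ := exists_pairZero_v_three_of_contact tabs hLc hrr hV hcE cVH hCv
  -- one rate
  set Θ : ℝ := max (max ΘU Θc) Θ₀ with hΘ
  have hΘ0 : 0 ≤ Θ := hΘ₀0.trans (le_max_right _ _)
  have hΘ1 : Θ < 1 := max_lt (max_lt hΘU1 hΘc1) hΘ₀1
  have hUΘ : ΘU ≤ Θ := (le_max_left _ _).trans (le_max_left _ _)
  have hcΘ : Θc ≤ Θ := (le_max_right _ _).trans (le_max_left _ _)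
  have h0Θ : Θ₀ ≤ Θ := le_max_right _ _
  refine exists_hBdevV_three_of_supPairs_of_contact tabs hVff hVmm hLc hrr hV hcE cVH (p := p) (q := p + q) hCv
    ⟨CU + CPc + C₀, Θ, by positivity, hΘ0, hΘ1, fun k i hik κ u x z a b => ?_⟩
  have hki : 1 ≤ ((k - i : ℕ) : ℝ) := by exact_mod_cast Nat.succ_le_of_lt (Nat.sub_pos_of_lt hik)
  have hkiq : ((k - i : ℕ) : ℝ) ^ q ≤ ((k - i : ℕ) : ℝ) ^ (p + q) := pow_le_pow_right₀ hki (by omega)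
  have hkip : ((k - i : ℕ) : ℝ) ^ p ≤ ((k - i : ℕ) : ℝ) ^ (p + q) := pow_le_pow_right₀ hki (by omega)
  have hkiq1 : 1 ≤ ((k - i : ℕ) : ℝ) ^ (p + q) := one_le_pow₀ hki
  have hΘk : 0 ≤ Θ ^ k := pow_nonneg hΘ0 k
  rcases Nat.eq_zero_or_pos i with hi | hi
  · -- the pair `i = 0`: both members by the lineage letters (§3), decay forgotten
    subst hi
    have h := (locStencil_zero_iff_supBound.1 (locStencil_zero_of_locStencil (hZ k hik) hδ₀.le)) κ u x z a b
    refine h.trans ?_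
    have hp : Θ₀ ^ k ≤ Θ ^ k := pow_le_pow_left₀ hΘ₀0 h0Θ k
    calc C₀ * ((((k - 0 : ℕ) : ℝ)) ^ p * Θ₀ ^ k) ≤ C₀ * ((((k - 0 : ℕ) : ℝ)) ^ (p + q) * Θ ^ k) := by gcongr
      _ ≤ (CU + CPc + C₀) * ((((k - 0 : ℕ) : ℝ)) ^ (p + q) * Θ ^ k) := by
          have : C₀ ≤ CU + CPc + C₀ := by linarith
          exact mul_le_mul_of_nonneg_right this (by positivity)
  · -- births `i ≥ 1`: dressed pair = RAW undressed pair + contact pair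
    have hC := hPc k i hi hik κ u x z a b
    have hUp := hU k i hi hik κ u x z a b
    simp only [Pi.sub_apply] at hC hUp ⊢
    -- `|a − c| ≤ |b − d| + |(a − b) − (c − d)|`
    have h4 : ∀ a' b' c' d' : ℝ, |a' - c'| ≤ |b' - d'| + |a' - b' - (c' - d')| := fun a' b' c' d' => by
      have e : a' - c' = (b' - d') + (a' - b' - (c' - d')) := by ring
      rw [e]; exact abs_add_le _ _
    refine (h4 _ _ _ _).trans ((add_le_add hUp hC).trans ?_)
    -- the two letters against the common constant
    set X : ℝ := (((k - i : ℕ) : ℝ)) ^ (p + q) * Θ ^ k with hX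
    have hX0 : 0 ≤ X := by positivity
    have hUb : CU * ΘU ^ k ≤ CU * X := by
      rw [hX]
      refine mul_le_mul_of_nonneg_left ?_ hCU
      calc ΘU ^ k ≤ Θ ^ k := pow_le_pow_left₀ hΘU0.le hUΘ _
        _ = 1 * Θ ^ k := (one_mul _).symm
        _ ≤ (((k - i : ℕ) : ℝ)) ^ (p + q) * Θ ^ k := mul_le_mul_of_nonneg_right hkiq1 hΘk
    have hCb : CPc * ((((k - i : ℕ) : ℝ)) ^ q * Θc ^ k) ≤ CPc * X := by
      rw [hX]
      refine mul_le_mul_of_nonneg_left ?_ hCPc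
      have hp : Θc ^ k ≤ Θ ^ k := pow_le_pow_left₀ hΘc0 hcΘ _
      exact mul_le_mul hkiq hp (pow_nonneg hΘc0 _) (by positivity)
    have hC0b : 0 ≤ C₀ * X := mul_nonneg hC₀ hX0
    have e : (CU + CPc + C₀) * X = CU * X + CPc * X + C₀ * X := by ring
    rw [e]
    linarith

end Three

end Summit.QuantumFields.BalabanUV.Beta.GAN24.CombBornBorderDriftAssembly

end
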